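import Summits.BirchSwinnertonDyer.BirchSwinnertonDyer.Theorems.UniversalToricDescentToricKernelAtThreeApZeroOddDefectPTOfPrint
import HarnessLib

/-!
# TURNKEY closer for kernel⁗ `ToricKernelAtThreeApZeroOddDefectPTTROfPrint` (stmt-BirchSwinnertonDyer-27389; route
# `UniversalToricDescent` rev 55, act R of pen bsd-wall-pss3x g5) — written by the pen as a certificate; to be PROPOSED by a
# prover seat verbatim as `Theorems/UniversalToricDescentToricKernelAtThreeApZeroOddDefectPTTROfPrint.lean --workitem
# stmt-BirchSwinnertonDyer-27389` (the pen never proposes).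

§1 the twin trichotomy of p619971 §2 with the très-ramifié-keyed ♭B′ (27401 `TwinWanFrameAtThreeMultTresT`) and the
peu-ramifié multiplicative RESUPPLY S_A (27387 `PeuRamifieMultTwinResupplyAtThree`): the handed semistable twin W′ is either
off the peu-ramifié multiplicative locus (good ss → a₃ = 0 resupply → ♭C₀_T 27173; good ordinary → Yan–Zhu 5.7, k = 0;
multiplicative très ramifié → ♭B′) or it is multiplicative with 3 ∣ v₃(Δ_min W′) and S_A swaps it for a twin off the locus.
§2 kernel⁗ HOLDS (`toricKernelAtThreeApZeroOddDefectPTTROfPrint_proof`), plus the monotonicity lemmas ♭B_T 27172 ⟹ ♭B′ 27401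
and package_T 27156 ⟹ P_R 27388, and S_A ⟸ «a good twin exists».
HONEST FRAMING: CONDITIONAL on every displayed hypothesis; BSD is proved for no curve by this file; std axioms only.
-/

noncomputable section

open scoped Classical

set_option linter.dupNamespace false
set_option autoImplicit false

namespace Summit.BirchSwinnertonDyer.BirchSwinnertonDyer.Theorems.UniversalToricDescentKernelDefectPTTROfPrint

open WeierstrassCurve NumberField IsDedekindDomain Field
  Literature.NumberTheory.EllipticCurves
  Literature.NumberTheory.EllipticCurves.ModularForms
  Literature.NumberTheory.EllipticCurves.Rank1Residual
  Literature.NumberTheory.EllipticCurves.KrizLi2019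
  Literature.NumberTheory.EllipticCurves.LiuZhangZhang2018
  Summit.BirchSwinnertonDyer.Rank1Residual
  Summit.BirchSwinnertonDyer.Rank1Residual.Additive
  Summit.BirchSwinnertonDyer.Rank1Residual.X11b
  Summit.BirchSwinnertonDyer.Rank1Residual.X11b.AcSelmer
  Summit.BirchSwinnertonDyer.Rank1Residual.X11b.Halves
  Summit.BirchSwinnertonDyer.BirchSwinnertonDyer.Theses.UniversalToricDescent
  Summit.BirchSwinnertonDyer.BirchSwinnertonDyer.Theorems
  Summit.BirchSwinnertonDyer.BirchSwinnertonDyer.Theorems.UniversalToricDescentTwinChoice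
  Summit.BirchSwinnertonDyer.BirchSwinnertonDyer.Theorems.UniversalToricDescentWaldspurgerFlat
  Summit.BirchSwinnertonDyer.BirchSwinnertonDyer.Theorems.UniversalToricDescentKernelOdd
  Summit.BirchSwinnertonDyer.BirchSwinnertonDyer.Theorems.UniversalToricDescentKernelOfPrint
  Summit.BirchSwinnertonDyer.BirchSwinnertonDyer.Theorems.UniversalToricDescentKernelFlatOfPrint
  Summit.BirchSwinnertonDyer.BirchSwinnertonDyer.Theorems.UniversalToricDescentDefectPTSqueeze

  Summit.BirchSwinnertonDyer.BirchSwinnertonDyer.Theorems.UniversalToricDescentKernelDefectPTOfPrint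

/-! ## §1 The twin trichotomy with the très-ramifié ♭B′ and the resupply -/

/-- p619971 §2 with `hB` keyed to très ramifié twins and the peu-ramifié case RESUPPLIED off the locus. [folklore] -/
theorem bsdp_three_of_defectPT_of_nonOrdBucketsTR_odd (hF : ToricPublishedInputs)
    (hD : DefectTransportModThreePT) (hwall : AdditiveSplitIMCInclusionAtThree) (hmu : TwinMuZeroAtThree)
    (hPT : PoitouTateSelmerStructureDualityFact) (hPT2 : PoitouTateShaTateDualFact) (hYZ : YanZhuMainConjectureInput)
    (hB : ∀ (W' : WeierstrassCurve ℚ) [W'.IsElliptic] [W'.IsGloballyMinimal] (N' : ℕ) [NeZero N'] (K : Type) [Field K]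
      [NumberField K] (Dt' : ModularParametrizationData W' N'),
      Mult W' 3 → W'.HasSurjectiveModNGaloisRep 3 → W'.conductorNorm ℤ = N' → IsImaginaryQuadratic K →
      SatisfiesHeegnerHypothesis N' K → Odd (NumberField.discr K) → ¬ 3 ∣ padicValInt 3 W'.minimalDiscriminantInt →
      ∀ (κ : ZpExtension K 3), κ.IsAnticyclotomic → ∀ (γ : absoluteGaloisGroup K) [Fact (κ.IsTopGenerator γ)]
        (𝔭 : HeightOneSpectrum (𝓞 K)), ((3 : ℕ) : 𝓞 K) ∈ 𝔭.asIdeal →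
        𝔭.asIdeal.ramificationIdx (𝓞 ℚ) = 1 → 𝔭.asIdeal.inertiaDeg (𝓞 ℚ) = 1 →
        ∀ (𝔭' : HeightOneSpectrum (𝓞 K)), ((3 : ℕ) : 𝓞 K) ∈ 𝔭'.asIdeal → 𝔭' ≠ 𝔭 →
        ∀ (ι' : PadicAlgCl 3 ≃+* ℂ), SchneiderFree.BranchInducesPrime 3 ι' 𝔭 →
        ∃ (ΩK : ℂ) (Ωp : ℂ_[3]) (L : UnrSeries 3), ΩK ≠ 0 ∧ Ωp ≠ 0 ∧ IsBDPLFunction ι' 𝔭 κ γ Dt'.f ΩK Ωp L ∧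
          (Module.IsTorsion (IwasawaAlgebra 3) (XAc (W'.baseChange K) 3 κ 𝔭' ∅ γ) →
            ∃ k : ℕ, ∀ G ∈ (XAc.charIdeal (W'.baseChange K) 3 κ 𝔭' ∅ γ).map (PowerSeries.map (toUnr 3)),
              PowerSeries.C (((3 : ℕ) : unrIntegers 3) ^ k) * G ∈ Ideal.span {L}))
    (hS0 : ∀ (W' : WeierstrassCurve ℚ) [W'.IsElliptic] [W'.IsGloballyMinimal] (N' : ℕ) [NeZero N'] (K : Type) [Field K]
      [NumberField K] (Dt' : ModularParametrizationData W' N'),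
      GoodSS W' 3 → W'.frobeniusTrace 3 = 0 → W'.HasSurjectiveModNGaloisRep 3 → W'.conductorNorm ℤ = N' →
      IsImaginaryQuadratic K → SatisfiesHeegnerHypothesis N' K → Odd (NumberField.discr K) →
      ∀ (κ : ZpExtension K 3), κ.IsAnticyclotomic → ∀ (γ : absoluteGaloisGroup K) [Fact (κ.IsTopGenerator γ)]
        (𝔭 : HeightOneSpectrum (𝓞 K)), ((3 : ℕ) : 𝓞 K) ∈ 𝔭.asIdeal →
        𝔭.asIdeal.ramificationIdx (𝓞 ℚ) = 1 → 𝔭.asIdeal.inertiaDeg (𝓞 ℚ) = 1 →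
        ∀ (𝔭' : HeightOneSpectrum (𝓞 K)), ((3 : ℕ) : 𝓞 K) ∈ 𝔭'.asIdeal → 𝔭' ≠ 𝔭 →
        ∀ (ι' : PadicAlgCl 3 ≃+* ℂ), SchneiderFree.BranchInducesPrime 3 ι' 𝔭 →
        ∃ (ΩK : ℂ) (Ωp : ℂ_[3]) (L : UnrSeries 3), ΩK ≠ 0 ∧ Ωp ≠ 0 ∧ IsBDPLFunction ι' 𝔭 κ γ Dt'.f ΩK Ωp L ∧
          (Module.IsTorsion (IwasawaAlgebra 3) (XAc (W'.baseChange K) 3 κ 𝔭' ∅ γ) →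
            ∃ k : ℕ, ∀ G ∈ (XAc.charIdeal (W'.baseChange K) 3 κ 𝔭' ∅ γ).map (PowerSeries.map (toUnr 3)),
              PowerSeries.C (((3 : ℕ) : unrIntegers 3) ^ k) * G ∈ Ideal.span {L}))
    (hsupply : ∀ (W : WeierstrassCurve ℚ) [W.IsElliptic] [W.IsGloballyMinimal], Additive.ClassO6 W 3 →
      W.analyticRank = 1 → W.HasSurjectiveModNGaloisRep 3 → HasGoodSSTwinAtThree W →
      HasGoodSSApZeroTwinAtThree W)
    (hres : ∀ (W : WeierstrassCurve ℚ) [W.IsElliptic] [W.IsGloballyMinimal], Additive.ClassO6 W 3 →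
      W.analyticRank = 1 → W.HasSurjectiveModNGaloisRep 3 →
      (∃ (W' : WeierstrassCurve ℚ) (_ : W'.IsElliptic) (_ : W'.IsGloballyMinimal),
        O6.ModPCongruent W' W 3 ∧ Mult W' 3 ∧ 3 ∣ padicValInt 3 W'.minimalDiscriminantInt) →
      ∃ (W'' : WeierstrassCurve ℚ) (_ : W''.IsElliptic) (_ : W''.IsGloballyMinimal),
        O6.ModPCongruent W'' W 3 ∧ ¬ Addv W'' 3 ∧ (Mult W'' 3 → ¬ 3 ∣ padicValInt 3 W''.minimalDiscriminantInt))
    (hV : ∀ (W : WeierstrassCurve ℚ) [W.IsElliptic] [W.IsGloballyMinimal] (N : ℕ) [NeZero N] (K : Type)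
      [Field K] [NumberField K] (Dt : ModularParametrizationData W N) (H : HeegnerDatum N (NumberField.discr K))
      (ι : K →+* ℂ) (P : (W.baseChange K).toAffine.Point),
      Additive.ClassO6 W 3 → W.HasSurjectiveModNGaloisRep 3 → W.analyticRank = 1 → W.conductorNorm ℤ = N →
      IsImaginaryQuadratic K → SatisfiesHeegnerHypothesis N K → Odd (NumberField.discr K) →
      (W.quadraticTwist (NumberField.discr K : ℚ)).entireLFunction 1 ≠ 0 →
      (WeierstrassCurve.Affine.Point.map ι.toRatAlgHom) P = heegnerPointComplex Dt H → ¬ IsOfFinAddOrder P →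
      ∀ (κ : ZpExtension K 3), κ.IsAnticyclotomic → ∀ (γ : absoluteGaloisGroup K) [Fact (κ.IsTopGenerator γ)]
        (𝔭 : HeightOneSpectrum (𝓞 K)) (h𝔭 : ((3 : ℕ) : 𝓞 K) ∈ 𝔭.asIdeal)
        (he : 𝔭.asIdeal.ramificationIdx (𝓞 ℚ) = 1) (hf : 𝔭.asIdeal.inertiaDeg (𝓞 ℚ) = 1),
        ∃ ι' : PadicAlgCl 3 ≃+* ℂ, SchneiderFree.BranchInducesPrime 3 ι' 𝔭 ∧
          ∃ (ΩK : ℂ) (Ωp : ℂ_[3]) (L : UnrSeries 3), ΩK ≠ 0 ∧ Ωp ≠ 0 ∧ IsBDPLFunction ι' 𝔭 κ γ Dt.f ΩK Ωp L ∧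
            ∃ u : (unrIntegers 3)ˣ, L.HasValueAt 0 ((((u : unrIntegers 3) : unrIntegers 3) : ℂ_[3]) *
              (algebraMap ℚ_[3] ℂ_[3] (logOmega W 3 (embAt K 3 𝔭 h𝔭 he hf) P / (Dt.c : ℚ_[3]))) ^ 2))
    (hC : WildSplitControlAtThree) (hZ : WildRankZeroTwistAtThree) :
    ∀ (W : WeierstrassCurve ℚ) [W.IsElliptic] [W.IsGloballyMinimal], Additive.ClassO6 W 3 →
      W.analyticRank = 1 → W.HasSurjectiveModNGaloisRep 3 →
      (∃ (W' : WeierstrassCurve ℚ) (_ : W'.IsElliptic) (_ : W'.IsGloballyMinimal),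
        O6.ModPCongruent W' W 3 ∧ ¬ Addv W' 3 ∧ W'.HasSurjectiveModNGaloisRep 3) → BSDp W 3 := by
  -- act R (pen pss3x g5): p619971 §2 re-run with the très-ramifié-keyed ♭B′ and the peu-ramifié RESUPPLY
  intro W _ _ hO6 hr hsurj htwin
  -- the kernel at a twin OFF the peu-ramifié multiplicative locus
  have key : ∀ (W' : WeierstrassCurve ℚ) [W'.IsElliptic] [W'.IsGloballyMinimal], O6.ModPCongruent W' W 3 →
      ¬ Addv W' 3 → (Mult W' 3 → ¬ 3 ∣ padicValInt 3 W'.minimalDiscriminantInt) → BSDp W 3 := by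
    intro W' _ _ hcong hW'ss htres
    have hW'surj : W'.HasSurjectiveModNGaloisRep 3 := by
      obtain ⟨e, he⟩ := hcong
      refine GaloisImage.hasSurjectiveModNGaloisRep_of_torsionIso e.symm (fun σ Q ↦ ?_) hsurj
      apply e.injective
      rw [he, e.apply_symm_apply, e.apply_symm_apply]
    by_cases hgood : W'.HasGoodReductionAtPrime 3
    · by_cases hss : (3 : ℤ) ∣ W'.frobeniusTrace 3
      · obtain ⟨W'', hW''e, hW''m, hcong'', hW''ss, ha0⟩ :=
          hsupply W hO6 hr hsurj ⟨W', ‹_›, ‹_›, hcong, hgood, by exact_mod_cast hss⟩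
        have hW''surj : W''.HasSurjectiveModNGaloisRep 3 := by
          obtain ⟨e, he⟩ := hcong''
          refine GaloisImage.hasSurjectiveModNGaloisRep_of_torsionIso e.symm (fun σ Q ↦ ?_) hsurj
          apply e.injective
          rw [he, e.apply_symm_apply, e.apply_symm_apply]
        exact bsdp_three_of_twinWanFrameAtT_odd_of_defectPT hF hD hwall hmu hPT hPT2 hV hC hZ W hO6 hr hsurj W'' hcong''
          (fun h ↦ h.1 hW''ss.1)
          (fun N' _ K _ _ Dt' hN hK hHK hodd κ hκ γ _ 𝔭 h𝔭 he hf 𝔭' h𝔭' hne ι' hι ↦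
            hS0 W'' N' K Dt' hW''ss ha0 hW''surj hN hK hHK hodd κ hκ γ 𝔭 h𝔭 he hf 𝔭' h𝔭' hne ι' hι)
      · refine bsdp_three_of_twinWanFrameAtT_odd_of_defectPT hF hD hwall hmu hPT hPT2 hV hC hZ W hO6 hr hsurj W' hcong
          hW'ss ?_
        intro N' _ K _ _ Dt' hN hK hH hodd κ hκ γ _ 𝔭 h𝔭 he hf 𝔭' h𝔭' hne ι' hι
        obtain ⟨⟨ΩK, Ωp, L', hΩK, hΩp, hBDP'⟩, hall⟩ :=
          ThreeAdicImageOverK.twinSplitIMCAtThreeGoodOrd_of_yanZhu57 hYZ W' N' K Dt'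
            ⟨hgood, by exact_mod_cast hss⟩ hW'surj hN hK hH hodd κ hκ γ 𝔭 h𝔭 he hf 𝔭' h𝔭' hne ι' hι
        refine ⟨ΩK, Ωp, L', hΩK, hΩp, hBDP', fun _ ↦ ⟨0, fun G hG ↦ ?_⟩⟩
        rw [hall ΩK Ωp L' hΩK hΩp hBDP'] at hG
        simpa using hG
    · have hmult : W'.HasMultiplicativeReductionAtPrime 3 := by
        by_contra h
        exact hW'ss ⟨hgood, h⟩
      exact bsdp_three_of_twinWanFrameAtT_odd_of_defectPT hF hD hwall hmu hPT hPT2 hV hC hZ W hO6 hr hsurj W' hcong hW'ss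
        (fun N' _ K _ _ Dt' hN hK hHK hodd κ hκ γ _ 𝔭 h𝔭 he hf 𝔭' h𝔭' hne ι' hι ↦
          hB W' N' K Dt' hmult hW'surj hN hK hHK hodd (htres hmult) κ hκ γ 𝔭 h𝔭 he hf 𝔭' h𝔭' hne ι' hι)
  -- the handed twin is either off that locus (done) or resupplied off it (peu ramifié class)
  obtain ⟨W', hW'e, hW'm, hcong, hW'ss, -⟩ := htwin
  by_cases hpeu : Mult W' 3 ∧ 3 ∣ padicValInt 3 W'.minimalDiscriminantInt
  · obtain ⟨W'', hW''e, hW''m, hcong'', hW''ss, htres''⟩ := hres W hO6 hr hsurj ⟨W', hW'e, hW'm, hcong, hpeu.1, hpeu.2⟩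
    exact key W'' hcong'' hW''ss htres''
  · exact key W' hcong hW'ss (fun hm hdvd ↦ hpeu ⟨hm, hdvd⟩)

/-! ## §2 kernel⁗ holds; monotonicity -/

/-- **kernel⁗ HOLDS** (stmt-BirchSwinnertonDyer-27389; proof = p619971 §3 with §1 above). [folklore] -/
theorem toricKernelAtThreeApZeroOddDefectPTTROfPrint_proof : ToricKernelAtThreeApZeroOddDefectPTTROfPrint := by
  intro hF hD hA hM h3 hsupply hres hW hS hL hZ
  obtain ⟨hYZ, h1, h2⟩ := hL
  obtain ⟨hH, hB', hLZZ⟩ := hW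
  obtain ⟨hB, hS0⟩ := h3
  exact bsdp_three_of_defectPT_of_nonOrdBucketsTR_odd hF hD hA hM h1 h2 hYZ
    (fun W' _ _ N' _ K _ _ Dt' hm hsurj hN hK hH hodd hnd κ hκ γ _ 𝔭 h𝔭 he hf 𝔭' h𝔭' hne ι' hι ↦
      hB W' N' K Dt' hm hsurj hN hK hH hodd hnd κ hκ γ 𝔭 h𝔭 he hf 𝔭' h𝔭' hne ι' hι)
    (fun W' _ _ N' _ K _ _ Dt' hg ha hsurj hN hK hH hodd κ hκ γ _ 𝔭 h𝔭 he hf 𝔭' h𝔭' hne ι' hι ↦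
      hS0 W' N' K Dt' hg ha hsurj hN hK hH hodd κ hκ γ 𝔭 h𝔭 he hf 𝔭' h𝔭' hne ι' hι)
    (fun W _ _ hO6 hr hsurj htwin ↦ hsupply W hO6 hr hsurj htwin)
    (fun W _ _ hO6 hr hsurj htwin ↦ hres W hO6 hr hsurj htwin)
    (UniversalToricDescentKernelOdd.wildSplitWaldspurgerAtThreeOdd_of_lzz_of_frameOdd hLZZ (hS hH hB'))
    (UniversalToricDescentControl.wildSplitControlAtThree_of_poitouTate h1 h2) hZ

/-- MONOTONICITY: ♭B_T 27172 ⟹ ♭B′ (drop the binder) — every line registered on 27172 still closes ♭B′. [folklore] -/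
theorem twinWanFrameAtThreeMultTresT_of_multT (h : TwinWanFrameAtThreeMultT) : TwinWanFrameAtThreeMultTresT := by
  intro W' _ _ N' _ K _ _ Dt' hm hsurj hN hK hH hodd _ κ hκ γ _ 𝔭 h𝔭 he hf 𝔭' h𝔭' hne ι' hι
  exact h W' N' K Dt' hm hsurj hN hK hH hodd κ hκ γ 𝔭 h𝔭 he hf 𝔭' h𝔭' hne ι' hι

/-- MONOTONICITY: package_T 27156 ⟹ P_R. [folklore] -/
theorem nonOrdBucketsTR_of_nonOrdBucketsT (h : TwinWanFrameAtThreeNonOrdBucketsT) : TwinWanFrameAtThreeNonOrdBucketsTR :=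
  ⟨twinWanFrameAtThreeMultTresT_of_multT h.1, h.2⟩

/-- The supply S_A is implied by «a good-ordinary twin exists» (the intended proof shape: a Hesse-pencil member). [folklore] -/
theorem peuRamifieMultTwinResupplyAtThree_of_goodOrd
    (h : ∀ (W : WeierstrassCurve ℚ) [W.IsElliptic] [W.IsGloballyMinimal], Additive.ClassO6 W 3 →
      W.analyticRank = 1 → W.HasSurjectiveModNGaloisRep 3 →
      (∃ (W' : WeierstrassCurve ℚ) (_ : W'.IsElliptic) (_ : W'.IsGloballyMinimal),
        O6.ModPCongruent W' W 3 ∧ Mult W' 3 ∧ 3 ∣ padicValInt 3 W'.minimalDiscriminantInt) →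
      ∃ (W'' : WeierstrassCurve ℚ) (_ : W''.IsElliptic) (_ : W''.IsGloballyMinimal),
        O6.ModPCongruent W'' W 3 ∧ W''.HasGoodReductionAtPrime 3) :
    PeuRamifieMultTwinResupplyAtThree := by
  intro W _ _ hO6 hr hsurj hpeu
  obtain ⟨W'', e, m, hc, hg⟩ := h W hO6 hr hsurj hpeu
  exact ⟨W'', e, m, hc, fun ha ↦ ha.1 hg, fun hm ↦
    absurd hg (not_hasGoodReductionAtPrime_of_hasMultiplicativeReductionAtPrime (W := W'') 3 hm)⟩

/-- The rung leaf from the nine remaining displayed hypotheses, kernel⁗ discharged (= the route's `closes` ∘ §2). [folklore] -/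
theorem wAllExclAddWildRankOneSurjTwin_of_actR (hF : ToricPublishedInputs) (hP : ToricDefectWallMuAtThree)
    (h3 : TwinWanFrameAtThreeNonOrdBucketsTR) (hsupply : GoodSSApZeroTwinSupplyAtThree) (hR : PeuRamifieMultTwinResupplyAtThree)
    (hW : WildSplitPrintedInputsAtThree) (hS : WildSplitFrameAtThreeOddOfPrint) (hL : ToricPrintedLeavesAtThree)
    (hZ : WildRankZeroTwistAtThree) : Summit.BirchSwinnertonDyer.WAllExclAddWildRankOneSurjTwin :=
  -- buildfix (bf3-g30, class (i) drift, 2nd repair today): the route's `closes` was re-keyed again (16:10Z) to a DIFFERENT kernel item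
  -- (`ToricKernelAtThreeApZeroOddDegreeOfPrint`, binders `TwinDegreeFrameAtThree…`), so this closer of kernel⁗ `…OddDefectPTTROfPrint` no longer goes
  -- through `closes`; it inlines the rev-55/56 body of `closes` (= `wAllExclAddWildRankOneSurjTwin_of_forall` ∘ kernel⁗) with its accepted statement unchanged.
  Summit.BirchSwinnertonDyer.wAllExclAddWildRankOneSurjTwin_of_forall
    (toricKernelAtThreeApZeroOddDefectPTTROfPrint_proof hF hP.1 hP.2.1 hP.2.2 h3 hsupply hR hW hS hL hZ)

end Summit.BirchSwinnertonDyer.BirchSwinnertonDyer.Theorems.UniversalToricDescentKernelDefectPTTROfPrint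

end
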